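import Summits.PneNP.PneNP.Theorems.ConvexRankGatesCliqueExtLowerBoundWidthThresholdDefs
import Summits.PneNP.PneNP.Theorems.ConvexRankGatesCliqueExtLowerBoundUnitCnfConvGate
import Literature.Computability.Complexity.ExtMonotoneGates
import Literature.Computability.Complexity.MonotoneSwitching
import Mathlib

/-!
# The pattern function "all of `P` on" is ONE GRANK gate reading ONE CNF of unit clauses
(crux `ConvexRankGates.CliqueExtLowerBound`, stmt-PneNP-10682; line `width-threshold-certificate-sparsity`,
§1g `LocalityMustGrow`, registered sub-goal `exists_grankGate_unitCnf` of lead c13; `--supports stmt-PneNP-10682`)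

For a set `P` of edge slots of `K_m`, the monotone function `x ↦ [∀ e ∈ P, x e = 1]` is computed by the
identity gate `⟨1, v ↦ v 0⟩` fed with the single CNF `{{e} | e ∈ P}` of unit clauses (clause size `1 ≤ s - 1`
for `s ≥ 2`; one distinct child). The identity gate is a GRANK gate of dimension `1` over `ℚ`: take the `1 × 1`
pencil `K₀ = 0`, `K 0 = 1` with threshold `θ = 1`; its symbolic matrix is `X₀ • 1` if the wire is on — invertible,
of rank `1`, since `X₀ ≠ 0` in `Frac ℚ[X₀]` — and `0` (rank `0`) otherwise (`one_le_rank_symbolicMatrix_unit_iff`,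
`isGRankGate_id`); hence it is a GRANK gate of every dimension `d ≥ 1` (`IsGRankGate.mono`). The value of the
unit CNF, `EvalCNF {{e}}_{e ∈ P} x ↔ ∀ e ∈ P, x e = 1`, is the landed
`UnitCnfConvGate.evalCNF_image_singleton_iff` (sibling sub-goal `exists_convGate_unitCnf`). No new definitions.
[folklore]
-/

set_option linter.dupNamespace false

open Literature.Computability.Complexity Filter Finset
open Summit.PneNP.PneNP.Theorems.CliqueExtLowerBound.WidthThreshold

noncomputable section

namespace Summit.PneNP.PneNP.Theorems.CliqueExtLowerBound.WidthThreshold.UnitCnfGRankGate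

/-! ## §1 The identity gate is a GRANK gate of dimension `1` -/

/-- The symbolic matrix of the `1 × 1` pencil `K₀ = 0`, `K 0 = 1` over a field `F` at the input `v ∈ {0,1}¹`
is `X₀ • 1` if `v 0 = 1` and `0` otherwise. [folklore] -/
theorem symbolicMatrix_unit {F : Type*} [Field F] (v : Fin 1 → Bool) :
    symbolicMatrix (0 : Matrix (Fin 1) (Fin 1) F) (fun _ : Fin 1 => (1 : Matrix (Fin 1) (Fin 1) F)) v =
      if v 0 then (algebraMap (MvPolynomial (Fin 1) F) (FractionRing (MvPolynomial (Fin 1) F))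
        (MvPolynomial.X 0)) • (1 : Matrix (Fin 1) (Fin 1) (FractionRing (MvPolynomial (Fin 1) F))) else 0 := by
  simp only [symbolicMatrix, Matrix.map_zero _ (map_zero _), zero_add, Fin.sum_univ_one,
    Matrix.map_one _ (map_zero _) (map_one _)]

/-- Over a field, the symbolic matrix of the `1 × 1` pencil `K₀ = 0`, `K 0 = 1` has rank `≥ 1` iff the wire is
on: `X₀ ≠ 0` in the fraction field, so `X₀ • 1` is invertible, of rank `1`; the zero matrix has rank `0`.
[folklore] -/
theorem one_le_rank_symbolicMatrix_unit_iff {F : Type*} [Field F] (v : Fin 1 → Bool) :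
    1 ≤ (symbolicMatrix (0 : Matrix (Fin 1) (Fin 1) F)
        (fun _ : Fin 1 => (1 : Matrix (Fin 1) (Fin 1) F)) v).rank ↔ v 0 = true := by
  rw [symbolicMatrix_unit]
  cases v 0 with
  | false => simp
  | true =>
    have hc : algebraMap (MvPolynomial (Fin 1) F) (FractionRing (MvPolynomial (Fin 1) F))
        (MvPolynomial.X 0) ≠ 0 :=
      (map_ne_zero_iff _ (IsFractionRing.injective (MvPolynomial (Fin 1) F)
        (FractionRing (MvPolynomial (Fin 1) F)))).2 (MvPolynomial.X_ne_zero _)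
    have hU : IsUnit ((algebraMap (MvPolynomial (Fin 1) F) (FractionRing (MvPolynomial (Fin 1) F))
        (MvPolynomial.X 0)) • (1 : Matrix (Fin 1) (Fin 1) (FractionRing (MvPolynomial (Fin 1) F)))) := by
      rw [Matrix.isUnit_iff_isUnit_det, Matrix.det_smul, Matrix.det_one, mul_one, Fintype.card_fin,
        pow_one]
      exact isUnit_iff_ne_zero.2 hc
    rw [if_pos rfl, Matrix.rank_of_isUnit _ hU, Fintype.card_fin]
    exact iff_of_true le_rfl rfl

/-- **The identity gate `⟨1, v ↦ v 0⟩` is a GRANK gate of dimension `1`** (over `ℚ`: pencil `K₀ = 0`,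
`K 0 = 1`, threshold `θ = 1`). [folklore] -/
theorem isGRankGate_id : IsGRankGate 1 ⟨1, fun v => v 0⟩ :=
  ⟨ℚ, inferInstance, 1, 1, le_rfl, 0, fun _ => 1, fun v => (one_le_rank_symbolicMatrix_unit_iff v).symm⟩

/-! ## §2 The registered sub-goal -/

open Classical in
/-- **Registered sub-goal `exists_grankGate_unitCnf`** (line `width-threshold-certificate-sparsity`, §1g
`LocalityMustGrow`): for `d ≥ 1`, `s ≥ 2` and every set `P` of edge slots of `K_m`, the pattern function
"all of `P` on" is ONE GRANK gate of dimension `≤ d` — the identity gate `⟨1, v ↦ v 0⟩`, a GRANK gate of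
dimension `1` (`isGRankGate_id`, then `IsGRankGate.mono`) — reading ONE `s`-local CNF, the CNF of unit clauses
`{{e} | e ∈ P}` (at most one distinct child; clauses of size `1 ≤ s - 1`; value `∀ e ∈ P, x e = 1` by
`UnitCnfConvGate.evalCNF_image_singleton_iff`). [folklore] -/
theorem exists_grankGate_unitCnf : ∀ (m d s : ℕ), 1 ≤ d → 2 ≤ s → ∀ P : Finset (EV m),
    ∃ (φ : GateFn) (C : Fin φ.1 → Finset (Finset (EV m))), IsGRankGate d φ ∧ #(univ.image C) ≤ 1 ∧
      (∀ j, ∀ S ∈ C j, #S ≤ s - 1) ∧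
      ∀ x : EV m → Bool, φ.2 (fun j => decide (EvalCNF (C j) x)) = decide (∀ e ∈ P, x e = true) := by
  intro m d s hd hs P
  refine ⟨⟨1, fun v => v 0⟩, fun _ => P.image fun e => ({e} : Finset (EV m)), isGRankGate_id.mono hd,
    Finset.card_image_le.trans (by simp), fun j S hS => ?_, fun x => ?_⟩
  · obtain ⟨e, -, rfl⟩ := Finset.mem_image.1 hS
    rw [Finset.card_singleton]
    omega
  · exact decide_eq_decide.2 (UnitCnfConvGate.evalCNF_image_singleton_iff P x)

end Summit.PneNP.PneNP.Theorems.CliqueExtLowerBound.WidthThreshold.UnitCnfGRankGate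

end
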